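import Summits.BirchSwinnertonDyer.BirchSwinnertonDyer.Theorems.ClassRecordThreeEulerHalvesAtThreeCartanSupplyCubicHeckeSquare
import HarnessLib

/-!
# The cubic classes, III: `#K = (q−1)/3`, non-cubes, the three classes over a point of `ℙ¹`, and `fibreSum ∘ T`

Helper file `--supports stmt-BirchSwinnertonDyer-23422` (seat `bsd-stepL-tam3-p1` g23, LINE OWNER of crux 23422, line `cartan` v11), serving the registered
stub (SUPPLY) `stub_cartanTorusLatticeSupply` (memo `HOME/tam3-p1/g23/SUPPLY-ROAD-GG1.md` §2), continuing `…CubicClasses ∕ …CubicHecke`. For `q ≡ 1 (mod 3)`: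
`#K = (q−1)/3` (`card_cubes`), a non-cube `ζ` exists (`exists_nonCube`), `𝔽_q^× = K ⊔ ζK ⊔ ζ²K` (`mem_cubes_cosets`, via «at most three cube
roots of unity»), so the fibre of `toP1` through `x` is `{x, ρ_ζ x, ρ_{ζ²} x}` with three distinct points (`fibre_eq`, `sum_fibre`), and a function with
vanishing fibre sums satisfies `φ + sc ζ φ + sc ζ (sc ζ φ) = 0` (`add_sc_add_sc_sc_eq_zero`: on `V₁ = ker(ℤ[X] → ℤ[ℙ¹])` the scaling `R = sc ζ` has
`1 + R + R² = 0`). The vectors over a point `[v] ∈ ℙ¹` are the `q − 1` multiples `k v`, whence exactly `#K` VECTORS over a point `p` pair to a cube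
with a class `y` off `p` (`card_over_rel`), i.e. exactly ONE class over `p` is Hecke-related to `y`, and **`fibreSum_hecke`** :
`Σ_{x over p} (Tφ)(x) = Σ_y φ(y) − Σ_{y over p} φ(y)` — so `T` preserves `V₁`.
HONEST FRAMING: finite-field bookkeeping; nothing about SUPPLY, NUM, crux 23422 ∕ 19109 is proved here; BSD is proved for no curve. [folklore]
-/

namespace Summit.BirchSwinnertonDyer.BirchSwinnertonDyer.Theorems.CartanSupply.CubicFibres

open Summit.BirchSwinnertonDyer.BirchSwinnertonDyer.Theorems.CartanDegree
open Summit.BirchSwinnertonDyer.BirchSwinnertonDyer.Theorems.CartanTorusCubeCut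
open Summit.BirchSwinnertonDyer.BirchSwinnertonDyer.Theorems.CartanSupply.CubicClasses
open Summit.BirchSwinnertonDyer.BirchSwinnertonDyer.Theorems.CartanSupply.CubicHecke

set_option linter.dupNamespace false
set_option autoImplicit false

open scoped Classical

variable {q : ℕ} [Fact q.Prime]

/-! ## §1 `#K = (q−1)/3`, non-cubes, and the three cosets of `K` -/

/-- PROVED (`q ≡ 1 (3)`): `u ∈ K ↔ u^{(q−1)/3} = 1`. [folklore] -/
theorem mem_cubes_iff_pow (h1 : q % 3 = 1) (u : (ZMod q)ˣ) : u ∈ cubes q ↔ (u : ZMod q) ^ ((q - 1) / 3) = 1 := by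
  rw [mem_cubes_iff_val, CubicPointsFixed.cube_iff_pow h1 u.ne_zero]

/-- PROVED — **`#K = (q−1)/3`** (`q ≡ 1 (mod 3)`). [folklore] -/
theorem card_cubes (h1 : q % 3 = 1) : Nat.card (cubes q) = (q - 1) / 3 := by
  rw [← PS.card_cubeRoots h1, Nat.card_eq_fintype_card]
  rw [show Fintype.card (cubes q) = Fintype.card {u : (ZMod q)ˣ // u ∈ cubes q} from rfl, Fintype.card_subtype]
  congr 1
  exact Finset.filter_congr fun u _ => mem_cubes_iff_pow h1 u

/-- PROVED (`q ≡ 1 (3)`): a non-cube unit exists. [folklore] -/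
theorem exists_nonCube (h1 : q % 3 = 1) : ∃ ζ : (ZMod q)ˣ, ζ ∉ cubes q := by
  by_contra h0
  have h : ∀ ζ : (ZMod q)ˣ, ζ ∈ cubes q := fun ζ => Classical.not_not.mp fun hζ => h0 ⟨ζ, hζ⟩
  have hq : 7 ≤ q := by
    have hp : q.Prime := Fact.out
    have h2 := hp.two_le
    rcases Nat.lt_or_ge q 7 with hlt | hge
    · interval_cases q <;> simp_all (config := {decide := true})
    · exact hge
  have hcard : Nat.card (cubes q) = q - 1 := by
    rw [Nat.card_eq_fintype_card, show Fintype.card (cubes q) = Fintype.card {u : (ZMod q)ˣ // u ∈ cubes q} from rfl,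
      Fintype.card_subtype, Finset.filter_true_of_mem fun u _ => h u, Finset.card_univ, ZMod.card_units]
  rw [card_cubes h1] at hcard
  omega

/-- PROVED: the power `u ↦ u^{(q−1)/3}` lands in the cube roots of unity. [folklore] -/
theorem pow_k_cube (h1 : q % 3 = 1) (u : (ZMod q)ˣ) : ((u : ZMod q) ^ ((q - 1) / 3)) ^ 3 = 1 := by
  rw [← pow_mul, show (q - 1) / 3 * 3 = q - 1 by have := PS.three_mul_k h1; omega]
  exact ZMod.pow_card_sub_one_eq_one u.ne_zero

/-- PROVED: a finset of cube roots of unity has at most three elements. [folklore] -/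
theorem card_le_three_of_cube {S : Finset (ZMod q)} (hS : ∀ x ∈ S, x ^ 3 = 1) : S.card ≤ 3 := by
  have hsub : S ⊆ (Polynomial.nthRoots 3 (1 : ZMod q)).toFinset := by
    intro x hx
    rw [Multiset.mem_toFinset, Polynomial.mem_nthRoots (by norm_num)]
    exact hS x hx
  exact (Finset.card_le_card hsub).trans ((Multiset.toFinset_card_le _).trans (Polynomial.card_nthRoots 3 1))

/-- PROVED — **THE THREE COSETS**: for a non-cube `ζ`, every unit lies in `K`, `ζK` or `ζ²K`. [folklore] -/
theorem mem_cubes_cosets (h1 : q % 3 = 1) {ζ : (ZMod q)ˣ} (hζ : ζ ∉ cubes q) (u : (ZMod q)ˣ) :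
    u ∈ cubes q ∨ u * ζ⁻¹ ∈ cubes q ∨ u * (ζ ^ 2)⁻¹ ∈ cubes q := by
  -- `χ(u) = u^k` with `k = (q−1)/3`; `χ(ζ) = ω ≠ 1`, and `{1, ω, ω²}` are all the cube roots of unity
  set k := (q - 1) / 3 with hk
  set ω : ZMod q := (ζ : ZMod q) ^ k with hω
  have hω1 : ω ≠ 1 := fun h => hζ ((mem_cubes_iff_pow h1 ζ).mpr h)
  have hω3 : ω ^ 3 = 1 := pow_k_cube h1 ζ
  have hω2 : ω ^ 2 ≠ 1 := by
    intro h
    apply hω1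
    have h3 : ω ^ 3 = ω := by rw [pow_succ, h, one_mul]
    exact h3.symm.trans hω3
  have hω21 : ω ^ 2 ≠ ω := by
    intro h
    apply hω1
    have hω0 : ω ≠ 0 := by intro h0; rw [h0] at hω3; simp at hω3
    calc ω = ω ^ 2 * ω⁻¹ := by rw [sq, mul_assoc, mul_inv_cancel₀ hω0, mul_one]
      _ = 1 := by rw [h, mul_inv_cancel₀ hω0]
  set x : ZMod q := (u : ZMod q) ^ k with hx
  have hx3 : x ^ 3 = 1 := pow_k_cube h1 u
  -- `x ∈ {1, ω, ω²}`, else four distinct cube roots of unity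
  have hxmem : x = 1 ∨ x = ω ∨ x = ω ^ 2 := by
    by_contra hne0
    have hne : x ≠ 1 ∧ x ≠ ω ∧ x ≠ ω ^ 2 :=
      ⟨fun e => hne0 (Or.inl e), fun e => hne0 (Or.inr (Or.inl e)), fun e => hne0 (Or.inr (Or.inr e))⟩
    have hcard : ({1, ω, ω ^ 2, x} : Finset (ZMod q)).card = 4 := by
      rw [Finset.card_insert_of_notMem, Finset.card_insert_of_notMem, Finset.card_pair hne.2.2.symm]
      · simp only [Finset.mem_insert, Finset.mem_singleton, not_or]
        exact ⟨hω21.symm, hne.2.1.symm⟩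
      · simp only [Finset.mem_insert, Finset.mem_singleton, not_or]
        exact ⟨hω1.symm, hω2.symm, hne.1.symm⟩
    have hle := card_le_three_of_cube (S := ({1, ω, ω ^ 2, x} : Finset (ZMod q))) (by
      intro y hy
      simp only [Finset.mem_insert, Finset.mem_singleton] at hy
      rcases hy with rfl | rfl | rfl | rfl
      · exact one_pow 3
      · exact hω3
      · rw [← pow_mul, show 2 * 3 = 3 * 2 by norm_num, pow_mul, hω3, one_pow]
      · exact hx3)
    omega
  have hζk0 : ω ≠ 0 := by intro h0; rw [h0] at hω3; simp at hω3
  rcases hxmem with h | h | h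
  · exact Or.inl ((mem_cubes_iff_pow h1 u).mpr h)
  · right; left
    rw [mem_cubes_iff_pow h1, Units.val_mul, Units.val_inv_eq_inv_val, mul_pow, inv_pow, ← hx, ← hω, h, mul_inv_cancel₀ hζk0]
  · right; right
    rw [mem_cubes_iff_pow h1, Units.val_mul, Units.val_inv_eq_inv_val, Units.val_pow_eq_pow_val, mul_pow, inv_pow, ← hx,
      ← pow_mul, show 2 * k = k * 2 by ring, pow_mul, ← hω, h, mul_inv_cancel₀ (pow_ne_zero 2 hζk0)]

/-- PROVED: the square of a non-cube is a non-cube. [folklore] -/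
theorem sq_not_mem {ζ : (ZMod q)ˣ} (hζ : ζ ∉ cubes q) : ζ ^ 2 ∉ cubes q := by
  intro h
  apply hζ
  have h3 : ζ ^ 3 ∈ cubes q := (mem_cubes_iff _).mpr ⟨ζ, rfl⟩
  have : ζ = ζ ^ 3 * (ζ ^ 2)⁻¹ := by group
  rw [this]
  exact (cubes q).mul_mem h3 ((cubes q).inv_mem h)

/-! ## §2 The three classes over a point of `ℙ¹` -/

/-- PROVED — **THE FIBRE**: for a non-cube `ζ`, the classes over `toP1 x` are exactly `x`, `ρ_ζ x`, `ρ_{ζ²} x`. [folklore] -/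
theorem toP1_eq_iff_three (h1 : q % 3 = 1) {ζ : (ZMod q)ˣ} (hζ : ζ ∉ cubes q) (x z : X q) :
    toP1 z = toP1 x ↔ z = x ∨ z = ρX ζ x ∨ z = ρX (ζ ^ 2) x := by
  rw [toP1_eq_toP1_iff]
  constructor
  · rintro ⟨u, rfl⟩
    rcases mem_cubes_cosets h1 hζ u with h | h | h
    · left; rw [ρX_of_mem h, Equiv.Perm.one_apply]
    · right; left
      rw [show u = u * ζ⁻¹ * ζ by group, ρX_mul, ρX_of_mem h, one_mul]
    · right; right
      rw [show u = u * (ζ ^ 2)⁻¹ * ζ ^ 2 by group, ρX_mul, ρX_of_mem h, one_mul]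
  · rintro (rfl | rfl | rfl)
    · exact ⟨1, by rw [ρX_one, Equiv.Perm.one_apply]⟩
    · exact ⟨ζ, rfl⟩
    · exact ⟨ζ ^ 2, rfl⟩

/-- PROVED: the three classes over a point are distinct. [folklore] -/
theorem three_distinct {ζ : (ZMod q)ˣ} (hζ : ζ ∉ cubes q) (x : X q) :
    ρX ζ x ≠ x ∧ ρX (ζ ^ 2) x ≠ x ∧ ρX (ζ ^ 2) x ≠ ρX ζ x := by
  refine ⟨ρX_ne_self hζ x, ρX_ne_self (sq_not_mem hζ) x, ?_⟩
  intro h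
  apply ρX_ne_self hζ x
  rw [sq, ρX_mul, Equiv.Perm.mul_apply] at h
  exact (ρX ζ).injective h

/-- PROVED: the fibre as a three-element finset. [folklore] -/
theorem fibre_eq (h1 : q % 3 = 1) {ζ : (ZMod q)ˣ} (hζ : ζ ∉ cubes q) (x : X q) :
    (Finset.univ.filter fun z : X q => toP1 z = toP1 x) = {x, ρX ζ x, ρX (ζ ^ 2) x} := by
  ext z
  simp only [Finset.mem_filter, Finset.mem_univ, true_and, Finset.mem_insert, Finset.mem_singleton]
  exact toP1_eq_iff_three h1 hζ x z

/-- PROVED — **FIBRE SUMS ARE THREE-TERM SUMS**. [folklore] -/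
theorem sum_fibre (h1 : q % 3 = 1) {ζ : (ZMod q)ˣ} (hζ : ζ ∉ cubes q) {A : Type*} [AddCommMonoid A] (φ : X q → A) (x : X q) :
    ∑ z ∈ Finset.univ.filter (fun z : X q => toP1 z = toP1 x), φ z = φ x + φ (ρX ζ x) + φ (ρX (ζ ^ 2) x) := by
  obtain ⟨hd1, hd2, hd3⟩ := three_distinct hζ x
  rw [fibre_eq h1 hζ, Finset.sum_insert, Finset.sum_pair hd3.symm, add_assoc]
  simp only [Finset.mem_insert, Finset.mem_singleton, not_or]
  exact ⟨hd1.symm, hd2.symm⟩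

/-- PROVED — **`1 + R + R² = 0` ON `V₁`**: if all fibre sums of `φ` vanish then `φ + sc ζ φ + sc ζ (sc ζ φ) = 0` (`ζ` a non-cube). [folklore] -/
theorem add_sc_add_sc_sc_eq_zero (h1 : q % 3 = 1) {ζ : (ZMod q)ˣ} (hζ : ζ ∉ cubes q) (A : Type*) [CommRing A] (φ : X q → A)
    (hφ : ∀ p : Steinberg.P1 q, ∑ z ∈ Finset.univ.filter (fun z : X q => toP1 z = p), φ z = 0) :
    φ + sc A ζ φ + sc A ζ (sc A ζ φ) = 0 := by
  have hζ' : ζ⁻¹ ∉ cubes q := fun h => hζ (by simpa using (cubes q).inv_mem h)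
  funext x
  have h := hφ (toP1 x)
  rw [sum_fibre h1 hζ' φ x] at h
  simp only [Pi.add_apply, sc_apply, Pi.zero_apply]
  rw [← Equiv.Perm.mul_apply, ← ρX_mul, ← sq]
  exact h

/-! ## §3 Vectors over a point; `fibreSum ∘ T` -/

/-- PROVED: the vectors whose class lies over `[v] ∈ ℙ¹` are exactly the unit multiples of `v`; there are `#K`-many of them
pairing to a cube with a fixed independent `w`: `#{v′ over [v] : det(v′ | w) ∈ K} = #K`. [folklore] -/
theorem card_over_rel (v w : V0 q) (hD : dt (v : Fin 2 → ZMod q) w ≠ 0) :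
    (Finset.univ.filter fun v' : V0 q => toP1 (mk v') = toP1 (mk v) ∧ IsCubeUnit (dt (v' : Fin 2 → ZMod q) w)).card =
      Nat.card (cubes q) := by
  rw [← card_cubeUnits_mul hD]
  symm
  -- `α ↦ α v` from `{α : cube(α D)}` (all such `α` are units)
  refine Finset.card_bij (fun α hα => ⟨α • (v : Fin 2 → ZMod q), smul_ne_zero (fun h => by
      simp only [Finset.mem_filter, Finset.mem_univ, true_and] at hα
      rw [h, zero_mul] at hα
      exact hα.ne_zero rfl) v.2⟩)
    (fun α hα => ?_) (fun α hα β hβ h => ?_) (fun v' hv' => ?_)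
  · simp only [Finset.mem_filter, Finset.mem_univ, true_and] at hα ⊢
    have hα0 : α ≠ 0 := fun h => by rw [h, zero_mul] at hα; exact hα.ne_zero rfl
    refine ⟨?_, by rw [dt_smul_left]; exact hα⟩
    rw [toP1_mk, toP1_mk, Projectivization.mk_eq_mk_iff]
    exact ⟨Units.mk0 α hα0, rfl⟩
  · have h' := congrArg (fun z : V0 q => dt (z : Fin 2 → ZMod q) w) h
    simp only [dt_smul_left] at h'
    exact mul_right_cancel₀ hD h'
  · simp only [Finset.mem_filter, Finset.mem_univ, true_and] at hv'
    obtain ⟨hp, hc⟩ := hv'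
    rw [toP1_mk, toP1_mk, Projectivization.mk_eq_mk_iff] at hp
    obtain ⟨u, hu⟩ := hp
    refine ⟨(u : ZMod q), ?_, Subtype.ext hu⟩
    simp only [Finset.mem_filter, Finset.mem_univ, true_and]
    have : dt ((u : ZMod q) • (v : Fin 2 → ZMod q)) w = (u : ZMod q) * dt (v : Fin 2 → ZMod q) w := dt_smul_left _ _ _
    rw [← this]
    have hu' : ((u : ZMod q) • (v : Fin 2 → ZMod q)) = (v' : Fin 2 → ZMod q) := hu
    rw [hu']
    exact hc

/-- PROVED — **EXACTLY ONE CLASS OVER `p` IS RELATED TO A CLASS OFF `p`**. [folklore] -/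
theorem card_fibre_rel (x y : X q) (hy : toP1 y ≠ toP1 x) :
    (Finset.univ.filter fun z : X q => toP1 z = toP1 x ∧ rel z y).card = 1 := by
  obtain ⟨v, rfl⟩ := mk_surjective x
  obtain ⟨w, rfl⟩ := mk_surjective y
  have hD : dt (v : Fin 2 → ZMod q) w ≠ 0 := fun h => hy ((toP1_eq_iff_dt v w).mpr h)
  have hK : 0 < Nat.card (cubes q) := Nat.card_pos
  apply Nat.eq_of_mul_eq_mul_left hK
  have step : Nat.card (cubes q) * (Finset.univ.filter fun z : X q => toP1 z = toP1 (mk v) ∧ rel z (mk w)).card =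
      (Finset.univ.filter fun v' : V0 q => toP1 (mk v') = toP1 (mk v) ∧ rel (mk v') (mk w)).card := by
    convert (card_filter_V0_eq (q := q) (fun z => toP1 z = toP1 (mk v) ∧ rel z (mk w))).symm using 3
    congr 1
  rw [step, mul_one]
  have h1 : (Finset.univ.filter fun v' : V0 q => toP1 (mk v') = toP1 (mk v) ∧ rel (mk v') (mk w)) =
      Finset.univ.filter fun v' : V0 q => toP1 (mk v') = toP1 (mk v) ∧ IsCubeUnit (dt (v' : Fin 2 → ZMod q) w) :=
    Finset.filter_congr fun v' _ => by rw [rel_mk]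
  rw [h1, card_over_rel v w hD]

/-- PROVED — **`fibreSum ∘ T`**: `Σ_{x over p} (Tφ)(x) = Σ_y φ(y) − Σ_{y over p} φ(y)`. [folklore] -/
theorem fibreSum_hecke (A : Type*) [CommRing A] (φ : X q → A) (x₀ : X q) :
    ∑ x ∈ Finset.univ.filter (fun x : X q => toP1 x = toP1 x₀), hecke A φ x =
      ∑ y, φ y - ∑ y ∈ Finset.univ.filter (fun y : X q => toP1 y = toP1 x₀), φ y := by
  simp_rw [hecke_apply]
  rw [Finset.sum_comm]
  have key : ∀ y : X q, ∑ x ∈ Finset.univ.filter (fun x : X q => toP1 x = toP1 x₀), (if rel x y then φ y else 0) =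
      if toP1 y = toP1 x₀ then 0 else φ y := by
    intro y
    by_cases hy : toP1 y = toP1 x₀
    · rw [if_pos hy]
      apply Finset.sum_eq_zero
      intro x hx
      simp only [Finset.mem_filter, Finset.mem_univ, true_and] at hx
      rw [if_neg]
      intro hr
      exact toP1_ne_of_rel hr (hy.trans hx.symm)
    · rw [if_neg hy, ← Finset.sum_filter, Finset.sum_const, Finset.filter_filter, card_fibre_rel x₀ y hy, one_smul]
  simp_rw [key]
  rw [Finset.sum_ite, Finset.sum_const_zero, zero_add, eq_sub_iff_add_eq, add_comm]
  exact Finset.sum_filter_add_sum_filter_not Finset.univ (fun y : X q => toP1 y = toP1 x₀) φ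

end Summit.BirchSwinnertonDyer.BirchSwinnertonDyer.Theorems.CartanSupply.CubicFibres
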